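import Summits.ResolutionOfSingularities.ResolutionOfSingularities.Theorems.SectionAscentAffineToGlobalAffineSingularLocus
import Summits.ResolutionOfSingularities.ResolutionOfSingularities.Theorems.WildQuotientsWildQuotientResolutionStubStableAffineCoverBlowup
import Literature.AlgebraicGeometry.Resolution.BlowupsComposition
import Literature.AlgebraicGeometry.Resolution.BlowupsExistence
import Literature.AlgebraicGeometry.Resolution.BlowupsIntegral
import Literature.AlgebraicGeometry.Resolution.BlowupsProperProofs
import Literature.AlgebraicGeometry.Resolution.Temkin2008Localization
import Literature.AlgebraicGeometry.Motives.ProjectiveDescentNormProofs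
import Literature.AlgebraicGeometry.Motives.Varieties
import Literature.AlgebraicGeometry.Motives.VarietiesProperProofs
import HarnessLib

/-!
# Crux `AffineToGlobal` (stmt-ResolutionOfSingularities-15961), line `birth`: isolated
# singularities suffice (the endgame of the weak-frame cut)

Route `ResolutionOfSingularities/SectionAscent`, crux `AffineToGlobal`
(`Summit.ResolutionOfSingularities.ResolutionOfSingularities.Theses.SectionAscent.AffineToGlobal`:
affine `Sing`-exact one-shot resolutions in characteristic `p`, all dimensions and all fields ⇒
`ResolutionInChar p`), line `birth`, lead's skeleton (reshape 3). Support file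
(`--supports stmt-ResolutionOfSingularities-15961`): the skeleton's stub
`stub_isolatedSingularitiesSuffice` PROVED (registered signature verbatim).

**Statement (`stub_isolatedSingularitiesSuffice`).** Assume the crux's hypothesis (affine
`Sing`-exact one-shots in characteristic `p` in all dimensions, written out). Let `K` be a field
of characteristic `p`, `X ⊆ ℙⁿ_K` an integral closed subscheme and `π₁ : X₁ → X` a blowing up
along a non-zero ideal sheaf `J₁` whose source `X₁` has only FINITELY many non-regular points.
Then some blowing up `π : X' → X` along a non-zero ideal sheaf has regular source `X'`.

**Proof.** `X` is of finite type over `K` through the proper `ℙⁿ_K → Spec K`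
(`Motives.isProper_projectiveSpace`), hence Noetherian; `X₁` is integral (`IsBlowup.isIntegral`)
and of finite type over `K` (`π₁` is proper, `IsBlowup.isProper`). If `X₁` is already regular we
are done. Otherwise the images in `X` of the finitely many non-regular points of `X₁` lie in one
basic affine open `U = X ∩ D₊(F)`, `F` a form of positive degree (graded prime avoidance for the
closed immersion `ι : X → ℙⁿ_K = Proj K[x₀, …, xₙ]`, `GradedPrimeAvoidance.exists_form_basicOpen`;
`D₊(F)` is affine, `Proj.isAffineOpen_basicOpen`, and affineness is inherited along the affine
morphism `ι`). The restriction `π₁ ∣_ U : π₁⁻¹U → U` is a blowing up of the AFFINE scheme `U`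
(`IsBlowup.restrict`), so the finitely many non-regular points, all of which lie in `π₁⁻¹U`, lie
in one affine open `Ω' ⊆ π₁⁻¹U` (`exists_isAffineOpen_forall_mem_of_isBlowup`: the blow-up of an
affine scheme is `Proj` of a Rees algebra, and graded prime avoidance again), whose image `Ω` in
`X₁` is an affine open containing `Sing X₁`. The landed one-shot-sheaf lemma
`AffineSingularLocus.exists_oneShotSheaf_of_compl_regularLocus_subset` then produces an ideal
sheaf `J' ≠ 0` on `X₁` all of whose blowing ups are regular; blow up (`exists_isBlowup`) to get
`ρ : X' → X₁` with `X'` regular. Finally `ρ ≫ π₁` is a blowing up of the Noetherian `X` along some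
ideal sheaf `Q` (composition of blowing ups, Stacks 080B, `IsBlowup.exists_isBlowup_comp`), and
`Q ≠ 0` since otherwise `X'` would be empty (`IsBlowup.isEmpty_of_bot`), whereas `X'` is integral
(`IsBlowup.isIntegral`: `X₁` integral, `J' ≠ 0`), in particular non-empty.

## Sources

* D. Mumford, *Abelian Varieties*, Tata Inst. Studies in Math. 5, Oxford Univ. Press (1970), §7,
  Remark p. 69 ("any finite set of points of a quasi-projective variety is contained in an open
  affine subset"). [MumfordAV1970]
* The Stacks Project, Tag 080B (Lemma 31.32.14: a composition of blowing ups of a Noetherian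
  scheme is a blowing up). [StacksProject]
* M. Temkin, *Desingularization of quasi-excellent schemes in characteristic zero*, Adv. Math.
  219 (2008), §2.1 (blow-ups, `T`-supported blow-ups and their compositions). [Temkin2008]
-/

noncomputable section

set_option linter.dupNamespace false -- mandated namespace of this single-conjunct summit

open CategoryTheory CategoryTheory.Limits AlgebraicGeometry TopologicalSpace
open Literature.AlgebraicGeometry.Resolution

namespace Summit.ResolutionOfSingularities.ResolutionOfSingularities.Theorems.AffineToGlobal.IsolatedSingularitiesSuffice

/-- **Finitely many points of a blowing up of a closed subscheme of `ℙⁿ_K` lie in one affine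
open** (Mumford's remark "any finite set of points of a quasi-projective variety is contained in
an open affine subset" in the form needed here). Let `ι : X → ℙⁿ_K` be a closed immersion,
`π₁ : X₁ → X` a blowing up and `S ⊆ X₁` finite. Then there is an affine open `Ω ⊆ X₁` containing
`S`: the images `π₁(S)` lie in a basic affine open `U = ι⁻¹D₊(F)` (graded prime avoidance,
`GradedPrimeAvoidance.exists_form_basicOpen`, `Proj.isAffineOpen_basicOpen`, `ι` is affine);
`π₁ ∣_ U` is a blowing up of the affine `U` (`IsBlowup.restrict`), so `S`, seen in `π₁⁻¹U`, lies
in an affine open of `π₁⁻¹U` (`exists_isAffineOpen_forall_mem_of_isBlowup`), whose image in `X₁`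
is the required `Ω`. [cite: MumfordAV1970, §7, Remark p. 69] -/
theorem exists_isAffineOpen_forall_mem (K : Type) [Field K] (n : ℕ) {X X₁ : Scheme.{0}}
    (ι : X ⟶ (Literature.AlgebraicGeometry.Motives.projectiveSpace n K).left)
    [IsClosedImmersion ι] {π₁ : X₁ ⟶ X} {J₁ : X.IdealSheafData} (hπ₁ : IsBlowup π₁ J₁)
    (S : Set X₁) (hS : S.Finite) :
    ∃ Ω : X₁.Opens, IsAffineOpen Ω ∧ S ⊆ (Ω : Set X₁) := by
  classical
  -- `ℙⁿ_K = Proj K[x₀, …, xₙ]` (definitionally), graded by degree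
  letI := MvPolynomial.gradedAlgebra (σ := Fin (n + 1)) (R := K)
  let 𝒜 := MvPolynomial.homogeneousSubmodule (Fin (n + 1)) K
  let r : X ⟶ Proj 𝒜 := ι
  haveI : IsClosedImmersion r := ‹IsClosedImmersion ι›
  -- a form `F` of positive degree with `π₁(S) ⊆ ι⁻¹D₊(F) =: U`, an affine open of `X`
  obtain ⟨m, F, hm, hFm, hT, -⟩ :=
    Literature.AlgebraicGeometry.Motives.GradedPrimeAvoidance.exists_form_basicOpen 𝒜 r
      r.isClosedEmbedding.injective r.isClosedEmbedding.isClosedMap (hS.image π₁).toFinset ⊤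
      (fun _ _ => trivial)
  set U : X.Opens := r ⁻¹ᵁ Proj.basicOpen 𝒜 F with hUdef
  have hU : IsAffineOpen U := (Proj.isAffineOpen_basicOpen 𝒜 F hFm hm).preimage r
  have hSU : ∀ s ∈ S, π₁ s ∈ U := fun s hs =>
    hT (π₁ s) ((Set.Finite.mem_toFinset (hS.image π₁)).mpr ⟨s, hs, rfl⟩)
  -- `π₁ ∣_ U` is a blowing up of the affine `U`; `S`, seen in `π₁⁻¹U`, lies in an affine open
  haveI : IsAffine (U : Scheme.{0}) := hU
  have hπU : IsBlowup (π₁ ∣_ U) (J₁.comap U.ι) := hπ₁.restrict U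
  haveI : Finite S := hS.to_subtype
  let φ : S → (π₁ ⁻¹ᵁ U : Scheme.{0}) := fun s => ⟨(s : X₁), hSU s s.2⟩
  obtain ⟨Ω', hΩ', hSΩ'⟩ :=
    WildQuotientResolution.StableAffineCoverBlowup.exists_isAffineOpen_forall_mem_of_isBlowup hπU
      (Set.finite_range φ).toFinset
  -- its image in `X₁`
  refine ⟨(π₁ ⁻¹ᵁ U).ι ''ᵁ Ω', hΩ'.image_of_isOpenImmersion _, fun s hs => ?_⟩
  exact ⟨φ ⟨s, hs⟩, hSΩ' _ ((Set.Finite.mem_toFinset (Set.finite_range φ)).mpr ⟨⟨s, hs⟩, rfl⟩),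
    rfl⟩

/-- **STUB `stub_isolatedSingularitiesSuffice` of the birth skeleton (reshape 3), PROVED**
(registered signature verbatim) — isolated singularities suffice. Assume affine `Sing`-exact
one-shots in characteristic `p` in all dimensions. Let `X ⊆ ℙⁿ_K` be integral and closed
(`char K = p`) and `π₁ : X₁ → X` a blowing up along `J₁ ≠ 0` whose source has finitely many
non-regular points. Then some blowing up of `X` along a non-zero ideal sheaf is regular. Proof:
`X₁` is integral (`IsBlowup.isIntegral`) and of finite type over `K` (`π₁` is proper,
`ℙⁿ_K → Spec K` is proper); its finitely many non-regular points lie in one affine open `Ω`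
(`exists_isAffineOpen_forall_mem`); the landed
`AffineSingularLocus.exists_oneShotSheaf_of_compl_regularLocus_subset` gives `J' ≠ 0` on `X₁` all
of whose blowing ups are regular; blow up (`exists_isBlowup`) and compose: `X' → X₁ → X` is a
blowing up of the Noetherian `X` along some `Q` (`IsBlowup.exists_isBlowup_comp`, Stacks 080B),
and `Q ≠ 0` because `X'` is non-empty (`IsBlowup.isEmpty_of_bot`; `X'` is integral as a blowing
up of the integral `X₁` along `J' ≠ 0`).
[cite: MumfordAV1970, §7, Remark p. 69; StacksProject, Tag 080B] -/
theorem stub_isolatedSingularitiesSuffice (p : ℕ)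
    (h : ∀ d : ℕ, ∀ (K : Type) [Field K] [CharP K p] (A : Type) [CommRing A] [IsDomain A]
      [Algebra K A] [Algebra.FiniteType K A], ringKrullDim A < (d : WithBot ℕ∞) →
      ∃ I : Ideal A, I ≠ ⊥ ∧
        Literature.AlgebraicGeometry.Resolution.Scheme.IsRegular
          (Literature.AlgebraicGeometry.Resolution.affineBlowup I) ∧
        ∀ 𝔭 : PrimeSpectrum A, I ≤ 𝔭.asIdeal ↔
          ¬ IsRegularLocalRing (Localization.AtPrime 𝔭.asIdeal))
    (K : Type) [Field K] [CharP K p] (n : ℕ) (X : Scheme.{0})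
    (ι : X ⟶ (Literature.AlgebraicGeometry.Motives.projectiveSpace n K).left)
    (hι : IsClosedImmersion ι) (hX : IsIntegral X) (X₁ : Scheme.{0}) (π₁ : X₁ ⟶ X)
    (J₁ : X.IdealSheafData) (hJ₁ : J₁ ≠ ⊥) (hπ₁ : IsBlowup π₁ J₁)
    (hfin : (Scheme.regularLocus X₁)ᶜ.Finite) :
    ∃ (X' : Scheme.{0}) (π : X' ⟶ X) (J : X.IdealSheafData),
      J ≠ ⊥ ∧ IsBlowup π J ∧ Scheme.IsRegular X' := by
  haveI := hι
  haveI := hX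
  -- `X` is of finite type over `K`, hence Noetherian; `X₁` is integral, of finite type over `K`
  haveI : IsProper (Literature.AlgebraicGeometry.Motives.projectiveSpace n K).hom :=
    Literature.AlgebraicGeometry.Motives.isProper_projectiveSpace n K
  let f : X ⟶ Spec (.of K) := ι ≫ (Literature.AlgebraicGeometry.Motives.projectiveSpace n K).hom
  haveI : LocallyOfFiniteType f := inferInstance
  haveI : QuasiCompact f := inferInstance
  haveI : IsLocallyNoetherian X := LocallyOfFiniteType.isLocallyNoetherian f
  haveI : CompactSpace X := QuasiCompact.compactSpace_of_compactSpace f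
  haveI : IsNoetherian X := ⟨⟩
  haveI : IsIntegral X₁ := hπ₁.isIntegral hJ₁
  haveI : IsProper π₁ := hπ₁.isProper
  let f₁ : X₁ ⟶ Spec (.of K) := π₁ ≫ f
  haveI : LocallyOfFiniteType f₁ := inferInstance
  haveI : QuasiCompact f₁ := inferInstance
  -- the finitely many non-regular points of `X₁` lie in one affine open `Ω`
  obtain ⟨Ω, hΩ, hSing⟩ := exists_isAffineOpen_forall_mem K n ι hπ₁ (Scheme.regularLocus X₁)ᶜ hfin
  -- the one-shot ideal sheaf `J'` of `X₁` and its blowing up `ρ : X' → X₁`, which is regular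
  obtain ⟨J', hJ'ne, -, hJ'reg⟩ :=
    AffineSingularLocus.exists_oneShotSheaf_of_compl_regularLocus_subset p h K X₁ f₁ Ω hΩ hSing
  obtain ⟨X', ρ, hρ⟩ := exists_isBlowup X₁ J'
  have hreg : Scheme.IsRegular X' := hJ'reg X' ρ hρ
  -- compose: `ρ ≫ π₁` is a blowing up of the Noetherian `X` along some `Q ≠ 0`
  obtain ⟨Q, hQ, -⟩ := hπ₁.exists_isBlowup_comp hρ
  haveI : IsIntegral X' := hρ.isIntegral hJ'ne
  refine ⟨X', ρ ≫ π₁, Q, ?_, hQ, hreg⟩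
  rintro rfl
  exact (not_isEmpty_of_nonempty X') hQ.isEmpty_of_bot

end Summit.ResolutionOfSingularities.ResolutionOfSingularities.Theorems.AffineToGlobal.IsolatedSingularitiesSuffice

end
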